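import Summits.ResolutionOfSingularities.ResolutionOfSingularities.Theorems.HilbertSamuelEliminationCampaignW42Thm314PointLocusPointwise
import Summits.ResolutionOfSingularities.ResolutionOfSingularities.Theorems.HilbertSamuelEliminationCampaignW42ChartPrimeResidueField
import Literature.AlgebraicGeometry.Resolution.BlowupChartQuasiRegular
import HarnessLib

/-!
# [OURS · L1 W4.2] Hironaka's THEOREM IV at every near point `x'` whose residue field `κ(x')` is FORMALLY SMOOTH (separable)
# over `κ(x)` — the general separable case of F-51′ `Hironaka1970_thmIV`, every characteristic, `κ(x)` arbitrary, `x'` closed or not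
# (campaign s42, cell res-hironaka; `--supports` stmt-ResolutionOfSingularities-17845)

HONEST FRAMING. OURS (slot W4.2, prover res-L1-s42-pv-1, gen 7). This file closes the gap between
`normalConeIdeal_le_span_inter_multAlgebra_of_formallySmooth` (`…CampaignW42ThmIVOfFormallySmooth`: Th. IV at near points whose
CONE-POINT residue field `κ(𝔭_{x'})` is formally smooth over `κ(x)`) and a hypothesis on the point itself:

* **`exists_adjoin_ratios_eq_top`** — for a blow-up `π` of `X` in `D` and any generators `g` of `I_{D,x}` and chart datum `(t, u)`
  at `x'`: some `ū_{i₀}` is a unit and **`κ(x')` is generated over `κ(x)` by the affine coordinates `ū_j/ū_{i₀}`** (the stalk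
  `𝒪_{X',x'}` is a localization of the Rees chart `𝒪_{X,x}[g/g_{j₀}]`, Stacks 0804/052P; tree `IsBlowup.exists_reesChart_stalk`,
  `eval₂Hom_chartGen_surjective`);
* hence (`…CampaignW42ChartPrimeResidueField`: `κ(𝔭_{x'}) ≅ κ(x')(Z)`) **`normalConeIdeal_le_span_inter_multAlgebra_of_formallySmooth_residueField`**
  — [H4] THEOREM IV's conclusion at every near point `x'` with `κ(x')` FORMALLY SMOOTH over `κ(x)` (for fields: separable in the
  sense of EGA 0_IV 19.6.1 — separably generated extensions, separable algebraic ones, everything essentially of finite type over a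
  perfect field); **`hironaka1970_thmIV_of_formallySmooth`** — the body of the named fact VERBATIM with that one hypothesis inserted;
* consequences with no named fact: `dim_lt_dirDim_of_near_of_formallySmooth` (CJS Thm. 3.14 numerical, printed `CharHypothesis`),
  `tangentConeIdeal_le_span_inter_multAlgebra_of_formallySmooth`, `isOnProjDirectrix_of_near_of_formallySmooth` (point centre, locus
  form, (F1♯)).

Together with `…_of_perfectField` this is [H4] Th. IV at every near point EXCEPT those with INSEPARABLE (non-formally-smooth) residue
field extension `κ(x')/κ(x)` over an imperfect `κ(x)` — Dietel 2015 (9.2.7), open; Hironaka's `ν*`-proof only. NOT a statement of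
H. Hironaka's manuscript [Hironaka2017]. AI-written; AI review is weaker than expert review.
-/

noncomputable section

-- single-conjunct summit: the doubled namespace component `ResolutionOfSingularities` is mandated
set_option linter.dupNamespace false

open CategoryTheory AlgebraicGeometry TopologicalSpace IsLocalRing MvPolynomial
open Literature.AlgebraicGeometry.Resolution Literature.AlgebraicGeometry.Resolution.HironakaScheme
open Literature.RingTheory.HilbertSamuel Literature.RingTheory.MvPolynomial
open Literature.AlgebraicGeometry.CossartJannsenSaito2020

namespace Summit.ResolutionOfSingularities.ResolutionOfSingularities.Theorems

namespace CampaignW42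

universe u

section Generation

/-- **Residue field generation, abstract chart form.** `φ : A → B` a local homomorphism factoring as `χ ∘ ψ` through a ring
`R` («the chart ring») generated over `A` by elements `e_i`, with `B` a ring of fractions of `R` in the weak sense that every
`b ∈ B` satisfies `b · χ(s) = χ(r)` for some `r, s ∈ R` with `χ(s)` a unit: then `κ(B)` is generated over `κ(A)` by the residues
of the `χ(e_i)`. [cite: StacksProject, Tag 0804] -/
theorem adjoin_residue_eq_top_of_chart {A B R : Type u} [CommRing A] [IsLocalRing A] [CommRing B] [IsLocalRing B] [CommRing R]
    (φ : A →+* B) [IsLocalHom φ] (ψ : A →+* R) (χ : R →+* B) (hχ : ∀ a, χ (ψ a) = φ a) {ι : Type} (e : ι → R)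
    (hR : ∀ r : R, ∃ P : MvPolynomial ι A, MvPolynomial.eval₂Hom ψ e P = r)
    (hB : ∀ b : B, ∃ r s : R, IsUnit (χ s) ∧ b * χ s = χ r) :
    letI : Algebra (ResidueField A) (ResidueField B) := (ResidueField.map φ).toAlgebra
    IntermediateField.adjoin (ResidueField A) (Set.range fun i => residue B (χ (e i))) = ⊤ := by
  classical
  letI : Algebra (ResidueField A) (ResidueField B) := (ResidueField.map φ).toAlgebra
  -- every `residue (χ r)` is a polynomial in the generators over `κ(A)`
  have hpoly : ∀ r : R, residue B (χ r) ∈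
      IntermediateField.adjoin (ResidueField A) (Set.range fun i => residue B (χ (e i))) := by
    intro r
    obtain ⟨P, rfl⟩ := hR r
    induction P using MvPolynomial.induction_on with
    | C a =>
      rw [MvPolynomial.eval₂Hom_C, hχ, ← ResidueField.map_residue]
      exact IntermediateField.algebraMap_mem _ (residue A a)
    | add p q hp hq => rw [map_add, map_add, map_add]; exact add_mem hp hq
    | mul_X p i hp =>
      rw [map_mul, map_mul, map_mul, MvPolynomial.eval₂Hom_X']
      exact mul_mem hp (IntermediateField.subset_adjoin _ _ ⟨i, rfl⟩)
  rw [eq_top_iff]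
  intro y _
  obtain ⟨b, rfl⟩ := IsLocalRing.residue_surjective y
  obtain ⟨r, s, hs, hb⟩ := hB b
  have hs' : residue B (χ s) ≠ 0 := (residue_ne_zero_iff_isUnit _).mpr hs
  have hb' : residue B b = residue B (χ r) / residue B (χ s) := by
    rw [eq_div_iff hs', ← map_mul, hb]
  rw [hb']
  exact div_mem (hpoly r) (hpoly s)

variable {X X' : Scheme.{u}} [IsLocallyNoetherian X] {π : X' ⟶ X} {D : X.IdealSheafData}

set_option maxHeartbeats 400000 in
omit [IsLocallyNoetherian X] in
/-- **The residue field of a point of a blow-up is generated by the affine coordinates of the chart.** For a blow-up `π` of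
`X` in `D`, a point `x'` over `x`, generators `g` of `I_{D,x}` and a chart datum `(t, u)` at `x'` (`t` a non-zero-divisor,
`I_{D,x}𝒪_{X',x'} = (t)`, `π♯(g_i) = u_i t`): there is an index `i₀` with `ū_{i₀} ≠ 0` in `κ(x')` (so `X_{i₀} ∉ 𝔭_{x'}`) such that
`κ(x') = κ(x)(ū_j/ū_{i₀} : j)`. [cite: StacksProject, Tag 0804] -/
theorem exists_adjoin_ratios_eq_top (hπ : IsBlowup π D) (x' : X')
    {m : ℕ} (g : Fin m → X.presheaf.stalk (π.base x')) (hg : Ideal.span (Set.range g) = stalkIdeal D (π.base x'))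
    (t : X'.presheaf.stalk x') (ht : t ∈ nonZeroDivisors (X'.presheaf.stalk x'))
    (hmap : (stalkIdeal D (π.base x')).map (π.stalkMap x').hom = Ideal.span {t})
    (u : Fin m → X'.presheaf.stalk x') (hu : ∀ i, (π.stalkMap x').hom (g i) = u i * t) :
    ∃ i₀ : Fin m, MvPolynomial.X i₀ ∉ chartPrime (π.stalkMap x').hom u ∧
      letI : Algebra (ResidueField (X.presheaf.stalk (π.base x'))) (ResidueField (X'.presheaf.stalk x')) :=
        (ResidueField.map (π.stalkMap x').hom).toAlgebra
      IntermediateField.adjoin (ResidueField (X.presheaf.stalk (π.base x')))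
        (Set.range fun j => residue (X'.presheaf.stalk x') (u j) / residue (X'.presheaf.stalk x') (u i₀)) = ⊤ := by
  classical
  letI algκ : Algebra (ResidueField (X.presheaf.stalk (π.base x'))) (ResidueField (X'.presheaf.stalk x')) :=
    (ResidueField.map (π.stalkMap x').hom).toAlgebra
  -- a Rees chart through `x'`
  obtain ⟨j₀, 𝔴, χ, hχ, hloc, -⟩ := hπ.exists_reesChart_stalk x' g hg
  letI algCO : Algebra (chartRing g j₀) (X'.presheaf.stalk x') := χ.toAlgebra
  haveI : IsLocalization.AtPrime (X'.presheaf.stalk x') 𝔴.asIdeal := hloc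
  -- rescale: `t = w · π♯(g_{j₀})`, `π♯(g_{j₀}) = w' · t`, so `u_i = w' · χ(e_i)` with `w'` a unit
  have hcl : ∀ l, (π.stalkMap x').hom (g l) = χ (chartGen g j₀ l) * (π.stalkMap x').hom (g j₀) := fun l => by
    rw [← hχ, ← hχ, reesChartBase_apply_eq_mul_chartGen g j₀ l, map_mul, mul_comm]
  have hgj₀ : (π.stalkMap x').hom (g j₀) ∈ Ideal.span {t} := by
    rw [← hmap]
    exact Ideal.mem_map_of_mem _ (by rw [← hg]; exact Ideal.subset_span ⟨j₀, rfl⟩)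
  obtain ⟨w', hw'⟩ := Ideal.mem_span_singleton'.mp hgj₀
  have ht_mem : t ∈ Ideal.span {(π.stalkMap x').hom (g j₀)} := by
    have h1 : Ideal.span {t} ≤ Ideal.span {(π.stalkMap x').hom (g j₀)} := by
      rw [← hmap, ← hg, Ideal.map_span, Ideal.span_le]
      rintro _ ⟨_, ⟨l, rfl⟩, rfl⟩
      rw [SetLike.mem_coe, hcl l]
      exact Ideal.mul_mem_left _ _ (Ideal.mem_span_singleton_self _)
    exact h1 (Ideal.mem_span_singleton_self t)
  obtain ⟨w, hw⟩ := Ideal.mem_span_singleton'.mp ht_mem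
  have hunit : w * w' = 1 := by
    have h1 : (w * w') * t = 1 * t := by rw [mul_assoc, hw', hw, one_mul]
    exact (mul_cancel_right_mem_nonZeroDivisors ht).mp h1
  have hw'unit : IsUnit w' := IsUnit.of_mul_eq_one _ (by rw [mul_comm]; exact hunit)
  have hui : ∀ i, u i = w' * χ (chartGen g j₀ i) := fun i => by
    have h1 : u i * t = (w' * χ (chartGen g j₀ i)) * t := by
      rw [← hu i, hcl i, ← hw']
      ring
    exact (mul_cancel_right_mem_nonZeroDivisors ht).mp h1
  have huj₀ : u j₀ = w' := by
    have h1 : chartGen g j₀ j₀ = 1 := chartGen_self g j₀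
    rw [hui j₀, h1, map_one, mul_one]
  have hw'res : residue (X'.presheaf.stalk x') w' ≠ 0 := (residue_ne_zero_iff_isUnit _).mpr hw'unit
  -- the affine coordinates are the residues of the chart generators
  have hratio : ∀ j, residue (X'.presheaf.stalk x') (u j) / residue (X'.presheaf.stalk x') (u j₀) =
      residue (X'.presheaf.stalk x') (χ (chartGen g j₀ j)) := fun j => by
    rw [hui j, huj₀, map_mul, mul_div_cancel_left₀ _ hw'res]
  refine ⟨j₀, ?_, ?_⟩
  · rw [mem_chartPrime_iff_of_isHomogeneous _ u (MvPolynomial.isHomogeneous_X _ j₀), chartEval_X, huj₀]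
    exact hw'res
  · -- the abstract generation lemma, for the generators `e_j`, `j ≠ j₀`
    have hB : ∀ b : X'.presheaf.stalk x', ∃ r s : chartRing g j₀, IsUnit (χ s) ∧ b * χ s = χ r := by
      intro b
      obtain ⟨⟨r, s⟩, hrs⟩ := IsLocalization.mk'_surjective 𝔴.asIdeal.primeCompl b
      refine ⟨r, s.1, IsLocalization.map_units (X'.presheaf.stalk x') s, ?_⟩
      rw [← hrs]
      exact IsLocalization.mk'_spec (X'.presheaf.stalk x') r s
    have hR : ∀ r : chartRing g j₀, ∃ P : MvPolynomial {j : Fin m // j ≠ j₀} (X.presheaf.stalk (π.base x')),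
        MvPolynomial.eval₂Hom (chartBase g j₀) (fun j : {j : Fin m // j ≠ j₀} => chartGen g j₀ j.1) P = r :=
      eval₂Hom_chartGen_surjective g j₀
    have hgen := adjoin_residue_eq_top_of_chart (π.stalkMap x').hom (chartBase g j₀) χ hχ
      (fun j : {j : Fin m // j ≠ j₀} => chartGen g j₀ j.1) hR hB
    rw [eq_top_iff, ← hgen]
    refine IntermediateField.adjoin.mono _ _ _ ?_
    rintro _ ⟨j, rfl⟩
    exact ⟨j.1, hratio j.1⟩

end Generation

section Schemes

variable {X X' : Scheme.{u}} [IsLocallyNoetherian X] {π : X' ⟶ X} {D : X.IdealSheafData}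

/-- **[H4] THEOREM IV at a near point with FORMALLY SMOOTH (separable) residue field extension `κ(x')/κ(x)`.** For a
blow-up `π` of `X` in `D`, permissible at `x = π x'` with `𝒪_{X,x}` universally catenary, `x'` NEAR to `x` at level `N`,
generators `g` of `I_{D,x}` and a chart datum `(t, u)` at `x'`: if `κ(x')` is formally smooth over `κ(x)` (through `π`), then
`J_D ≤ span(J_D ∩ U(𝔭_{x'}))`. [cite: Hironaka1970NumericalCharacters, THEOREM IV p. 156 and (14.3) p. 170]
[cite: Dietel2015, Prop. (9.2.6) p. 112–113] -/
theorem normalConeIdeal_le_span_inter_multAlgebra_of_formallySmooth_residueField (hπ : IsBlowup π D) (x' : X')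
    (hperm : IdealSheafData.IsPermissibleAt D (π.base x'))
    (hUC : IsUniversallyCatenaryRing (X.presheaf.stalk (π.base x'))) {N : ℕ} (hnear : IsNearPoint π N x')
    {m : ℕ} (g : Fin m → X.presheaf.stalk (π.base x')) (hg : Ideal.span (Set.range g) = stalkIdeal D (π.base x'))
    (t : X'.presheaf.stalk x') (ht : t ∈ nonZeroDivisors (X'.presheaf.stalk x'))
    (hmap : (stalkIdeal D (π.base x')).map (π.stalkMap x').hom = Ideal.span {t})
    (u : Fin m → X'.presheaf.stalk x') (hu : ∀ i, (π.stalkMap x').hom (g i) = u i * t)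
    (hfs : letI : Algebra (ResidueField (X.presheaf.stalk (π.base x'))) (ResidueField (X'.presheaf.stalk x')) :=
        (ResidueField.map (π.stalkMap x').hom).toAlgebra;
      Algebra.FormallySmooth (ResidueField (X.presheaf.stalk (π.base x'))) (ResidueField (X'.presheaf.stalk x'))) :
    normalConeIdeal g ≤ Ideal.span
      ((normalConeIdeal g : Set (MvPolynomial (Fin m) (ResidueField (X.presheaf.stalk (π.base x'))))) ∩
        (multAlgebra (ResidueField (X.presheaf.stalk (π.base x'))) (chartPrime (π.stalkMap x').hom u) :
          Set (MvPolynomial (Fin m) (ResidueField (X.presheaf.stalk (π.base x')))))) := by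
  obtain ⟨i₀, hi₀, hgen⟩ := exists_adjoin_ratios_eq_top hπ x' g hg t ht hmap u hu
  exact normalConeIdeal_le_span_inter_multAlgebra_of_formallySmooth hπ x' hperm hUC hnear g hg t ht hmap u hu
    (formallySmooth_residueField_chartPrime_of_formallySmooth (π.stalkMap x').hom u i₀ hi₀ hgen hfs)

/-- **CJS Thm. 3.14 (numerical form, general permissible centre) at every near point with formally smooth `κ(x')/κ(x)`,
under the printed `CharHypothesis X x` — no named fact.** [cite: CossartJannsenSaito2020, Thm. 3.14] -/
theorem dim_lt_dirDim_of_near_of_formallySmooth (π : X' ⟶ X) (D : X.IdealSheafData) (hexc : Scheme.IsExcellent X)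
    (hperm : IdealSheafData.IsPermissible D) (hπ : IsBlowup π D) (N : ℕ)
    (x' : X') (hxD : π.base x' ∈ D.support) (hCH : CharHypothesis X (π.base x'))
    (hnear : Scheme.hsFun X' N x' = Scheme.hsFun X N (π.base x'))
    (hfs : letI : Algebra (ResidueField (X.presheaf.stalk (π.base x'))) (ResidueField (X'.presheaf.stalk x')) :=
        (ResidueField.map (π.stalkMap x').hom).toAlgebra;
      Algebra.FormallySmooth (ResidueField (X.presheaf.stalk (π.base x'))) (ResidueField (X'.presheaf.stalk x'))) :
    ringKrullDim (X.presheaf.stalk (π.base x') ⧸ stalkIdeal D (π.base x')) <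
      (Scheme.dirDim X (π.base x') : WithBot ℕ∞) :=
  dim_lt_dirDim_of_thmIVAt π D hperm hπ x' hxD hCH
    fun _m g t u hgI _hm ht hmap hu =>
      normalConeIdeal_le_span_inter_multAlgebra_of_formallySmooth_residueField hπ x' (hperm _ hxD)
        (hexc.isUniversallyCatenaryRing_stalk _) hnear g hgI t ht hmap u hu hfs

/-- **[H4] THEOREM IV for the blow-up of a closed point `x`, at a near point `x'` with formally smooth `κ(x')/κ(x)`**
(F-51 `Hironaka1970_thmIV_point`'s body at such a point). [cite: Hironaka1970NumericalCharacters, THEOREM IV p. 156 L11–12; p. 170 L3–9 (14.3)] -/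
theorem tangentConeIdeal_le_span_inter_multAlgebra_of_formallySmooth (π : X' ⟶ X) (x : X) (hx : IsClosed ({x} : Set X))
    (N : ℕ) (x' : X') (hexc : Scheme.IsExcellent X)
    (hperm : IdealSheafData.IsPermissible (Scheme.IdealSheafData.vanishingIdeal ⟨{x}, hx⟩))
    (hπ : IsBlowup π (Scheme.IdealSheafData.vanishingIdeal ⟨{x}, hx⟩)) (hxx' : π.base x' = x)
    (hnear : Scheme.hsFun X' N x' = Scheme.hsFun X N x)
    (hfs : letI : Algebra (ResidueField (X.presheaf.stalk (π.base x'))) (ResidueField (X'.presheaf.stalk x')) :=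
        (ResidueField.map (π.stalkMap x').hom).toAlgebra;
      Algebra.FormallySmooth (ResidueField (X.presheaf.stalk (π.base x'))) (ResidueField (X'.presheaf.stalk x')))
    {e : ℕ} (g : Fin e → X.presheaf.stalk (π.base x'))
    (hg : Ideal.span (Set.range g) = maximalIdeal (X.presheaf.stalk (π.base x')))
    (t : X'.presheaf.stalk x') (u : Fin e → X'.presheaf.stalk x')
    (ht : t ∈ nonZeroDivisors (X'.presheaf.stalk x'))
    (hmap : (maximalIdeal (X.presheaf.stalk (π.base x'))).map (π.stalkMap x').hom = Ideal.span {t})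
    (hu : ∀ i, (π.stalkMap x').hom (g i) = u i * t) :
    tangentConeIdeal g hg ≤ Ideal.span
      ((tangentConeIdeal g hg : Set (MvPolynomial (Fin e) (ResidueField (X.presheaf.stalk (π.base x'))))) ∩
        (multAlgebra (ResidueField (X.presheaf.stalk (π.base x'))) (chartPrime (π.stalkMap x').hom u) :
          Set (MvPolynomial (Fin e) (ResidueField (X.presheaf.stalk (π.base x')))))) := by
  subst hxx'
  set D : X.IdealSheafData := Scheme.IdealSheafData.vanishingIdeal ⟨{π.base x'}, hx⟩ with hD
  have hxD : π.base x' ∈ (D.support : Set X) := by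
    rw [hD, Scheme.IdealSheafData.coe_support_vanishingIdeal]
    exact Set.mem_singleton _
  have hstalk : stalkIdeal D (π.base x') = maximalIdeal (X.presheaf.stalk (π.base x')) :=
    stalkIdeal_vanishingIdeal_singleton hx
  have hgD : Ideal.span (Set.range g) = stalkIdeal D (π.base x') := hg.trans hstalk.symm
  have hmapD : (stalkIdeal D (π.base x')).map (π.stalkMap x').hom = Ideal.span {t} := by rw [hstalk]; exact hmap
  have h' := normalConeIdeal_le_span_inter_multAlgebra_of_formallySmooth_residueField hπ x' (hperm _ hxD)
    (hexc.isUniversallyCatenaryRing_stalk _) hnear g hgD t ht hmapD u hu hfs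
  rwa [normalConeIdeal_eq_tangentConeIdeal g hg] at h'

/-- **CJS Thm. 3.14 (point centre, locus form) at every near point `x'` with formally smooth `κ(x')/κ(x)` — `κ(x)` arbitrary,
no named fact**: `x' ∈ ℙ(Dir_x(X))` under (F1♯) `char κ(x) = 0 ∨ ē_x(X) + 2 ≤ 2·char κ(x)`. [cite: CossartJannsenSaito2020, Thm. 3.14] -/
theorem isOnProjDirectrix_of_near_of_formallySmooth (π : X' ⟶ X) (x : X) (hx : IsClosed ({x} : Set X)) (N : ℕ) (x' : X')
    (hexc : Scheme.IsExcellent X)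
    (hperm : IdealSheafData.IsPermissible (Scheme.IdealSheafData.vanishingIdeal ⟨{x}, hx⟩))
    (hπ : IsBlowup π (Scheme.IdealSheafData.vanishingIdeal ⟨{x}, hx⟩)) (hxx' : π.base x' = x)
    (hgeo : SigmaMaxModificationsCorridor3.Moving.GeomDirHypothesis X x)
    (hnear : Scheme.hsFun X' N x' = Scheme.hsFun X N x)
    (hfs : letI : Algebra (ResidueField (X.presheaf.stalk (π.base x'))) (ResidueField (X'.presheaf.stalk x')) :=
        (ResidueField.map (π.stalkMap x').hom).toAlgebra;
      Algebra.FormallySmooth (ResidueField (X.presheaf.stalk (π.base x'))) (ResidueField (X'.presheaf.stalk x'))) :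
    IsOnProjDirectrix π x' := by
  refine isOnProjDirectrix_of_thmIVPointAt π x hx x' hπ hxx' hgeo ?_
  intro e g hg t u _he ht hmap hu
  subst hxx'
  exact tangentConeIdeal_le_span_inter_multAlgebra_of_formallySmooth π (π.base x') hx N x' hexc hperm hπ rfl hnear hfs
    g hg t u ht hmap hu

end Schemes

/-! ## The statement of `Hironaka1970_thmIV`, verbatim, with the one added hypothesis «`κ(x')/κ(x)` formally smooth» -/

section Verbatim

/-- **`Hironaka1970_thmIV` at points with formally smooth (= separable) residue field extension** — the body of the named
fact `Literature.AlgebraicGeometry.Resolution.Hironaka1970_thmIV` with its binders in the same order and ONE inserted hypothesis,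
`Algebra.FormallySmooth κ(x) κ(x')` for the algebra structure of `π`; PROVED. What is left of the printed fact is exactly the
inseparable case. [cite: Hironaka1970NumericalCharacters, THEOREM IV p. 156 and (14.3) p. 170] -/
theorem hironaka1970_thmIV_of_formallySmooth :
    ∀ (X X' : Scheme.{u}) [IsLocallyNoetherian X] (π : X' ⟶ X) (D : X.IdealSheafData) (N : ℕ)
      (x' : X') (x : X),
      Scheme.IsExcellent X → IdealSheafData.IsPermissible D → IsBlowup π D →
      topologicalKrullDim ↥X ≤ (N : WithBot ℕ∞) → π.base x' = x → x ∈ (D.support : Set X) →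
      Scheme.hsFun X' N x' = Scheme.hsFun X N x →
      (letI : Algebra (ResidueField (X.presheaf.stalk (π.base x'))) (ResidueField (X'.presheaf.stalk x')) :=
          (ResidueField.map (π.stalkMap x').hom).toAlgebra;
        Algebra.FormallySmooth (ResidueField (X.presheaf.stalk (π.base x'))) (ResidueField (X'.presheaf.stalk x'))) →
      ∀ (m : ℕ) (g : Fin m → X.presheaf.stalk (π.base x'))
        (t : X'.presheaf.stalk x') (u : Fin m → X'.presheaf.stalk x'),
        Ideal.span (Set.range g) = stalkIdeal D (π.base x') →
        (stalkIdeal D (π.base x')).spanFinrank = m →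
        t ∈ nonZeroDivisors (X'.presheaf.stalk x') →
        (stalkIdeal D (π.base x')).map (π.stalkMap x').hom = Ideal.span {t} →
        (∀ i, (π.stalkMap x').hom (g i) = u i * t) →
          normalConeIdeal g ≤ Ideal.span
            ((normalConeIdeal g : Set (MvPolynomial (Fin m) (ResidueField (X.presheaf.stalk (π.base x'))))) ∩
              (HironakaScheme.multAlgebra (ResidueField (X.presheaf.stalk (π.base x')))
                (_root_.Literature.RingTheory.HilbertSamuel.chartPrime (π.stalkMap x').hom u) :
                Set (MvPolynomial (Fin m) (ResidueField (X.presheaf.stalk (π.base x')))))) := by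
  intro X X' _ π D N x' x hexc hperm hπ _hdim hx hxD hnear hfs m g t u hgI _hm ht hmap hu
  subst hx
  exact normalConeIdeal_le_span_inter_multAlgebra_of_formallySmooth_residueField hπ x' (hperm _ hxD)
    (hexc.isUniversallyCatenaryRing_stalk _) hnear g hgI t ht hmap u hu hfs


/-! ## (appended, same seat) The statement of `Hironaka1970_thmIV_point` (F-51, point centre), verbatim, with the one added hypothesis -/

/-- **`Hironaka1970_thmIV_point` (F-51, [H4] Th. IV for the blow-up of a closed point) at points with formally smooth residue
field extension** — the body of the named fact `Literature.AlgebraicGeometry.Resolution.Hironaka1970_thmIV_point` with its binders in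
the same order and ONE inserted hypothesis, `Algebra.FormallySmooth κ(x) κ(x')`; PROVED.
[cite: Hironaka1970NumericalCharacters, THEOREM IV p. 156 L11–12; p. 170 L3–9 (14.3)] -/
theorem hironaka1970_thmIV_point_of_formallySmooth :
    ∀ (X X' : Scheme.{u}) [IsLocallyNoetherian X] (π : X' ⟶ X) (x : X) (hx : IsClosed ({x} : Set X))
      (N : ℕ) (x' : X'),
      Scheme.IsExcellent X →
      IdealSheafData.IsPermissible (Scheme.IdealSheafData.vanishingIdeal ⟨{x}, hx⟩) →
      IsBlowup π (Scheme.IdealSheafData.vanishingIdeal ⟨{x}, hx⟩) →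
      topologicalKrullDim ↥X ≤ (N : WithBot ℕ∞) → π.base x' = x →
      Scheme.hsFun X' N x' = Scheme.hsFun X N x →
      (letI : Algebra (ResidueField (X.presheaf.stalk (π.base x'))) (ResidueField (X'.presheaf.stalk x')) :=
          (ResidueField.map (π.stalkMap x').hom).toAlgebra;
        Algebra.FormallySmooth (ResidueField (X.presheaf.stalk (π.base x'))) (ResidueField (X'.presheaf.stalk x'))) →
      ∀ (e : ℕ) (g : Fin e → X.presheaf.stalk (π.base x'))
        (hg : Ideal.span (Set.range g) = maximalIdeal (X.presheaf.stalk (π.base x')))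
        (t : X'.presheaf.stalk x') (u : Fin e → X'.presheaf.stalk x'),
        (maximalIdeal (X.presheaf.stalk (π.base x'))).spanFinrank = e →
        t ∈ nonZeroDivisors (X'.presheaf.stalk x') →
        (maximalIdeal (X.presheaf.stalk (π.base x'))).map (π.stalkMap x').hom = Ideal.span {t} →
        (∀ i, (π.stalkMap x').hom (g i) = u i * t) →
          tangentConeIdeal g hg ≤ Ideal.span
            ((tangentConeIdeal g hg : Set (MvPolynomial (Fin e) (ResidueField (X.presheaf.stalk (π.base x'))))) ∩
              (HironakaScheme.multAlgebra (ResidueField (X.presheaf.stalk (π.base x')))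
                (_root_.Literature.RingTheory.HilbertSamuel.chartPrime (π.stalkMap x').hom u) :
                Set (MvPolynomial (Fin e) (ResidueField (X.presheaf.stalk (π.base x')))))) := by
  intro X X' _ π x hx N x' hexc hperm hπ _hdim hxx' hnear hfs e g hg t u _he ht hmap hu
  exact tangentConeIdeal_le_span_inter_multAlgebra_of_formallySmooth π x hx N x' hexc hperm hπ hxx' hnear hfs g hg t u ht hmap hu

/-- **`Hironaka1970_thmIV_point` (F-51) at closed points `x` with PERFECT residue field** — the body of the named fact with the
one inserted hypothesis `PerfectField κ(x)`; PROVED (from `tangentConeIdeal_le_span_inter_multAlgebra_of_perfectField`).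
[cite: Hironaka1970NumericalCharacters, THEOREM IV p. 156 L11–12; p. 170 L3–9 (14.3)] -/
theorem hironaka1970_thmIV_point_of_perfectField :
    ∀ (X X' : Scheme.{u}) [IsLocallyNoetherian X] (π : X' ⟶ X) (x : X) (hx : IsClosed ({x} : Set X))
      (N : ℕ) (x' : X'),
      Scheme.IsExcellent X →
      IdealSheafData.IsPermissible (Scheme.IdealSheafData.vanishingIdeal ⟨{x}, hx⟩) →
      IsBlowup π (Scheme.IdealSheafData.vanishingIdeal ⟨{x}, hx⟩) →
      topologicalKrullDim ↥X ≤ (N : WithBot ℕ∞) → π.base x' = x →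
      Scheme.hsFun X' N x' = Scheme.hsFun X N x →
      PerfectField (ResidueField (X.presheaf.stalk (π.base x'))) →
      ∀ (e : ℕ) (g : Fin e → X.presheaf.stalk (π.base x'))
        (hg : Ideal.span (Set.range g) = maximalIdeal (X.presheaf.stalk (π.base x')))
        (t : X'.presheaf.stalk x') (u : Fin e → X'.presheaf.stalk x'),
        (maximalIdeal (X.presheaf.stalk (π.base x'))).spanFinrank = e →
        t ∈ nonZeroDivisors (X'.presheaf.stalk x') →
        (maximalIdeal (X.presheaf.stalk (π.base x'))).map (π.stalkMap x').hom = Ideal.span {t} →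
        (∀ i, (π.stalkMap x').hom (g i) = u i * t) →
          tangentConeIdeal g hg ≤ Ideal.span
            ((tangentConeIdeal g hg : Set (MvPolynomial (Fin e) (ResidueField (X.presheaf.stalk (π.base x'))))) ∩
              (HironakaScheme.multAlgebra (ResidueField (X.presheaf.stalk (π.base x')))
                (_root_.Literature.RingTheory.HilbertSamuel.chartPrime (π.stalkMap x').hom u) :
                Set (MvPolynomial (Fin e) (ResidueField (X.presheaf.stalk (π.base x')))))) := by
  intro X X' _ π x hx N x' hexc hperm hπ _hdim hxx' hnear hperf e g hg t u _he ht hmap hu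
  exact tangentConeIdeal_le_span_inter_multAlgebra_of_perfectField π x hx N x' hexc hperm hπ hxx' hnear hperf g hg t u ht hmap hu

end Verbatim

end CampaignW42

end Summit.ResolutionOfSingularities.ResolutionOfSingularities.Theorems

end
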